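import Literature.NumberTheory.Automorphic.GodementJacquetZetaKernelTheta
import Literature.MeasureTheory.Group.CoveringWeights
import Literature.MeasureTheory.Group.BruhatFunction
import HarnessLib

/-!
# The covering weight of `GL_n(K)` attached to a Bruhat function of `A_G · GL_n(K)`

Topic `NumberTheory/Automorphic`; namespace `Literature.NumberTheory.Automorphic`. A Bruhat
function `β` of the closed subgroup `H = A_G GL_n(K)` of `G = GL_n(𝔸_K)` (`IsBruhatFunction`,
Folland (1995), Prop. 2.48: `β ≥ 0` continuous with `∫_H β(g h) dρ(h) = 1`) becomes, after
integrating out the split component `A_G`, a **covering weight** of the discrete group `GL_n(K)`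
acting on `G` by left multiplication (`Literature.MeasureTheory.Group.CoveringWeights`):

* `lintegral_quotientSubgroup_eq_mul_lintegral_tsum` — `∫_H f dρ = κ ∫_{A_G} Σ_{γ ∈ GL_n(K)} f(a γ) dα`
  for Borel `f ≥ 0`, from the product decomposition `ρ ≅ κ (α ⊗ count)`
  (`exists_map_quotientSubgroupEquiv_eq_smul_prod`; the Bochner version is
  `integral_quotientSubgroup_eq_smul_integral_tsum` of `GLnZetaKernel`);
* `gjWeight κ α β y = κ ∫_{A_G} β(y⁻¹ a) dα` (**definition**), `measurable_gjWeight`;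
* `coveringSum_gjWeight_eq_one` — **`Σ_{γ ∈ GL_n(K)} w(γ y) = 1`** (`a` is central, reindex
  `γ ↦ γ⁻¹`, decompose, `∫_H β(y⁻¹ h) dρ = 1`); `lintegral_center_bruhat_le` — `∫_{A_G} β(y⁻¹ a) dα ≤ κ⁻¹`;
  `toReal_gjWeight`.

This is the weight against which the singular theta terms of the Godement–Jacquet reflection
formula are unfolded (Godement–Jacquet (1972), §12), in the tree's "unfolding on the group"
formalism.

## References

* G. B. Folland, *A Course in Abstract Harmonic Analysis* (1995), §2.6, Prop. 2.48 [Folland1995].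
* R. Godement, H. Jacquet, *Zeta functions of simple algebras*, LNM 260 (1972), §12
  [GodementJacquetLNM260].
-/

noncomputable section

open MeasureTheory Measure Set Filter Topology IsDedekindDomain NumberField
open Literature.MeasureTheory.Group
open scoped ENNReal NNReal

namespace Literature.NumberTheory.Automorphic

variable {n : ℕ} {K : Type} [Field K] [NumberField K]

attribute [local instance] adelicBorel borelSpace_adelic locallyCompactSpace_adelic
  secondCountableTopology_gl_adelic

/-! ### The `lintegral` decomposition `∫_H f dρ = κ ∫_A Σ_γ f(a γ) dα` -/

/-- **`∫_{A_G GL_n(K)} f dρ = κ ∫_{A_G} Σ_{γ ∈ GL_n(K)} f(a γ) dα` for `f ≥ 0` Borel**, given the product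
decomposition `ρ ≅ κ · (α ⊗ count)` of the Haar measure of `H = A_G · GL_n(K)`
(`exists_map_quotientSubgroupEquiv_eq_smul_prod`). The `lintegral` companion of
`integral_quotientSubgroup_eq_smul_integral_tsum`. [folklore] -/
theorem lintegral_quotientSubgroup_eq_mul_lintegral_tsum
    {ρ : Measure (AdelicGroupData.gl n K).quotientSubgroup}
    {α : Measure (AdelicGroupData.gl n K).center'} [SFinite α] {κ : ℝ≥0}
    (hκ : ρ.map (quotientSubgroupEquiv n K) =
      κ • α.prod (count : Measure (AdelicGroupData.gl n K).arithmeticSubgroup))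
    {f : (AdelicGroupData.gl n K).quotientSubgroup → ℝ≥0∞} (hf : Measurable f) :
    ∫⁻ h, f h ∂ρ = κ * ∫⁻ a, ∑' γ : (AdelicGroupData.gl n K).arithmeticSubgroup,
      f ((quotientSubgroupEquiv n K).symm (a, γ)) ∂α := by
  haveI : BorelSpace (AdelicGroupData.gl n K).arithmeticSubgroup := Subtype.borelSpace _
  haveI : BorelSpace ((AdelicGroupData.gl n K).center' × (AdelicGroupData.gl n K).arithmeticSubgroup) :=
    Prod.borelSpace
  set e := quotientSubgroupEquiv n K with he
  set em : (AdelicGroupData.gl n K).quotientSubgroup ≃ᵐ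
      (AdelicGroupData.gl n K).center' × (AdelicGroupData.gl n K).arithmeticSubgroup :=
    e.toHomeomorph.toMeasurableEquiv with hem
  have hem' : (em : (AdelicGroupData.gl n K).quotientSubgroup →
      (AdelicGroupData.gl n K).center' × (AdelicGroupData.gl n K).arithmeticSubgroup) = e := rfl
  have hF : Measurable fun p : (AdelicGroupData.gl n K).center' × (AdelicGroupData.gl n K).arithmeticSubgroup =>
      f (e.symm p) := hf.comp em.symm.measurable
  -- `∫ f dρ = ∫ f ∘ e⁻¹ d(ρ.map e)`
  have h1 : ∫⁻ h, f h ∂ρ = ∫⁻ p, f (e.symm p) ∂(ρ.map e) := by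
    rw [← hem', lintegral_map_equiv]
    refine lintegral_congr fun h => ?_
    change f h = f (e.symm (e h))
    rw [ContinuousMulEquiv.symm_apply_apply]
  rw [h1, hκ, lintegral_smul_measure, lintegral_prod _ hF.aemeasurable]
  simp only [lintegral_count]
  rfl

/-! ### The weight -/

variable (κ : ℝ≥0) (α : Measure (AdelicGroupData.gl n K).center') (β : (AdelicGroupData.gl n K).Adelic → ℝ)

/-- **The covering weight attached to a Bruhat function `β` of `H = A_G GL_n(K)`**:
`w(y) = κ ∫_{A_G} β(y⁻¹ a) dα(a)` (for the action of `GL_n(K)` on `GL_n(𝔸_K)` by left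
multiplication; the inversion turns the right `H`-periodicity of Bruhat functions into covering sums
for the left action). [folklore] -/
def gjWeight (y : (AdelicGroupData.gl n K).Adelic) : ℝ≥0∞ :=
  κ * ∫⁻ a : (AdelicGroupData.gl n K).center', ENNReal.ofReal (β (y⁻¹ * (a : (AdelicGroupData.gl n K).Adelic))) ∂α

variable {κ α β}

/-- Unfolding of `gjWeight`. [folklore] -/
theorem gjWeight_apply (y : (AdelicGroupData.gl n K).Adelic) :
    gjWeight κ α β y = κ * ∫⁻ a : (AdelicGroupData.gl n K).center',
      ENNReal.ofReal (β (y⁻¹ * (a : (AdelicGroupData.gl n K).Adelic))) ∂α := rfl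

/-- **The weight is Borel measurable** (`β` continuous, `α` s-finite). [folklore] -/
theorem measurable_gjWeight [SFinite α] (hβ : Continuous β) : Measurable (gjWeight κ α β) := by
  unfold gjWeight
  refine Measurable.const_mul ?_ _
  have hj : Measurable fun p : (AdelicGroupData.gl n K).Adelic × (AdelicGroupData.gl n K).center' =>
      ENNReal.ofReal (β (p.1⁻¹ * (p.2 : (AdelicGroupData.gl n K).Adelic))) :=
    (hβ.comp ((continuous_fst.inv).mul (continuous_subtype_val.comp continuous_snd))).measurable.ennreal_ofReal
  exact hj.lintegral_prod_right'

/-- **The covering sums of the weight are `1`**: for a Bruhat function `β` of `H = A_G GL_n(K)`,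
`Σ_{γ ∈ GL_n(K)} w(γ y) = κ Σ_γ ∫_A β(y⁻¹ γ⁻¹ a) dα = ∫_H β(y⁻¹ h) dρ(h) = 1` (`a` central,
reindexing `γ ↦ γ⁻¹`, the product decomposition of `ρ`, and `∫_H β(g h) dρ(h) = 1`). [folklore] -/
theorem coveringSum_gjWeight_eq_one
    {ρ : Measure (AdelicGroupData.gl n K).quotientSubgroup}
    [SFinite α] (hκ : ρ.map (quotientSubgroupEquiv n K) =
      κ • α.prod (count : Measure (AdelicGroupData.gl n K).arithmeticSubgroup))
    (hβ : IsBruhatFunction (AdelicGroupData.gl n K).quotientSubgroup ρ β)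
    (y : (AdelicGroupData.gl n K).Adelic) :
    coveringSum (AdelicGroupData.gl n K).arithmeticSubgroup (gjWeight κ α β) y = 1 := by
  rw [coveringSum_apply]
  simp_rw [gjWeight_apply]
  rw [ENNReal.tsum_mul_left]
  -- measurability of the terms
  have hm : ∀ γ : (AdelicGroupData.gl n K).arithmeticSubgroup, Measurable fun a : (AdelicGroupData.gl n K).center' =>
      ENNReal.ofReal (β ((γ • y)⁻¹ * (a : (AdelicGroupData.gl n K).Adelic))) := fun γ =>
    (hβ.continuous.comp (continuous_const.mul continuous_subtype_val)).measurable.ennreal_ofReal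
  rw [← lintegral_tsum fun γ => (hm γ).aemeasurable]
  -- pointwise: `Σ_γ β(y⁻¹ γ⁻¹ a) = Σ_γ β(y⁻¹ a γ)`
  have hpt : ∀ a : (AdelicGroupData.gl n K).center',
      ∑' γ : (AdelicGroupData.gl n K).arithmeticSubgroup,
          ENNReal.ofReal (β ((γ • y)⁻¹ * (a : (AdelicGroupData.gl n K).Adelic))) =
        ∑' γ : (AdelicGroupData.gl n K).arithmeticSubgroup,
          ENNReal.ofReal (β (y⁻¹ * (((quotientSubgroupEquiv n K).symm (a, γ) :
            (AdelicGroupData.gl n K).quotientSubgroup) : (AdelicGroupData.gl n K).Adelic))) := by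
    intro a
    rw [← (Equiv.inv (AdelicGroupData.gl n K).arithmeticSubgroup).tsum_eq]
    refine tsum_congr fun γ => ?_
    simp only [Equiv.inv_apply, coe_quotientSubgroupEquiv_symm_apply]
    congr 2
    rw [Subgroup.smul_def, smul_eq_mul, mul_inv_rev, Subgroup.coe_inv, inv_inv, mul_assoc]
    congr 1
    have h := centerval_mul_comm a (Units.val (γ : (AdelicGroupData.gl n K).Adelic))
    exact Units.ext h.symm
  simp_rw [hpt]
  -- the product decomposition, backwards
  have hf : Measurable fun h : (AdelicGroupData.gl n K).quotientSubgroup =>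
      ENNReal.ofReal (β (y⁻¹ * (h : (AdelicGroupData.gl n K).Adelic))) :=
    (hβ.continuous.comp (continuous_const.mul continuous_subtype_val)).measurable.ennreal_ofReal
  rw [← lintegral_quotientSubgroup_eq_mul_lintegral_tsum hκ hf]
  -- `∫_H β(y⁻¹ h) dρ = 1`
  rw [← ofReal_integral_eq_lintegral_ofReal (hβ.integrable_fiber y⁻¹) (ae_of_all _ fun h => hβ.nonneg _),
    hβ.integral_fiber y⁻¹, ENNReal.ofReal_one]

/-- **The fibre integrals over `A_G` are finite**: `∫_{A_G} β(y⁻¹ a) dα ≤ κ⁻¹` (one term of the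
covering sum). [folklore] -/
theorem lintegral_center_bruhat_le
    {ρ : Measure (AdelicGroupData.gl n K).quotientSubgroup}
    [SFinite α] (hκ : ρ.map (quotientSubgroupEquiv n K) =
      κ • α.prod (count : Measure (AdelicGroupData.gl n K).arithmeticSubgroup))
    (hβ : IsBruhatFunction (AdelicGroupData.gl n K).quotientSubgroup ρ β)
    (y : (AdelicGroupData.gl n K).Adelic) :
    ∫⁻ a : (AdelicGroupData.gl n K).center', ENNReal.ofReal (β (y⁻¹ * (a : (AdelicGroupData.gl n K).Adelic))) ∂α ≤ (κ : ℝ≥0∞)⁻¹ := by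
  have h1 : gjWeight κ α β y ≤ 1 := by
    calc gjWeight κ α β y = gjWeight κ α β ((1 : (AdelicGroupData.gl n K).arithmeticSubgroup) • y) := by rw [one_smul]
      _ ≤ coveringSum (AdelicGroupData.gl n K).arithmeticSubgroup (gjWeight κ α β) y :=
          ENNReal.le_tsum (1 : (AdelicGroupData.gl n K).arithmeticSubgroup)
      _ = 1 := coveringSum_gjWeight_eq_one hκ hβ y
  rw [gjWeight_apply] at h1
  rw [ENNReal.le_inv_iff_mul_le, mul_comm]
  exact h1

/-- **The real value of the weight**: `w(y).toReal = κ ∫_{A_G} β(y⁻¹ a) dα` (`β ≥ 0` continuous).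
[folklore] -/
theorem toReal_gjWeight (hβc : Continuous β) (hβ0 : ∀ x, 0 ≤ β x) (y : (AdelicGroupData.gl n K).Adelic) :
    (gjWeight κ α β y).toReal = (κ : ℝ) * ∫ a : (AdelicGroupData.gl n K).center', β (y⁻¹ * (a : (AdelicGroupData.gl n K).Adelic)) ∂α := by
  rw [gjWeight_apply, ENNReal.toReal_mul, ENNReal.coe_toReal]
  congr 1
  refine (integral_eq_lintegral_of_nonneg_ae (ae_of_all _ fun a => hβ0 _) ?_).symm
  exact (hβc.comp (continuous_const.mul continuous_subtype_val)).aestronglyMeasurable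

end Literature.NumberTheory.Automorphic
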